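import Mathlib
import HarnessLib
import Summits.QuantumAdvantage.QuantumAdvantage.Theses.DyadicGap
import Literature.Computability.Complexity.Classes
import Literature.Computability.Cryptography.ClassBQP

/-!
# Birth skeleton for piece X₁ `QSignNotInP` (split `dyadicgap-derandomization-cut` of crux `Target`, stmt-QuantumAdvantage-1840)

Piece X₁ = "some poly-time uniform oracle-free Toffoli+H family with polynomially quantized diagonal amplitudes has its sign
language outside `P`" (quantized Toffoli+H signs beat DETERMINISTIC polynomial time). Line "exact-first" — the lower end of
the route's own sandwich `coEQP_{T+H} ≤ QSign` (route items CoExactIsQuantizedSign, ExactDequantOfQSignDequant) pointed at `P`: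

* `stub_coexact` (PROVABLE, M-sized; literally the route's support item `CoExactIsQuantizedSign`, stmt-QuantumAdvantage-1847):
  every zero-error uniform oracle-free Toffoli+H language is, up to complement, the sign language of an INTEGRALLY quantized
  family (`V ; Z₀ ; V⁻¹`, amplitude `1 − 2·p_acc ∈ {±1}`);
* `stub_exactToffoliHNotInP` (OPEN; "EQP over Toffoli+H is not inside P": `∃ L ∈ BQPWith toffoliH 0, L ∉ P`) — strictly STRONGER
  than the piece on paper (exact ⊂ quantized) and the natural source of quantized witnesses; no candidate language is in print
  (de Beaudrap 2015 §6; Ambainis 2013 gives exact speed-ups for TOTAL functions only in the query model);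
* `QSignNotInP_of` (kernel-checked): take `L` exact and outside `P`, realise `Lᶜ` as a `q = 0` sign language by `stub_coexact`,
  and use closure of `P` under complement (`compl_mem_P_iff`).
Sorries: exactly 2, inside the stubs. Sources: deBeaudrap2015 (Prop 1–2, §6), BrassardHoyer1997, Ambainis2013 (arXiv:1211.0721),
NishimuraOzawa2002.
-/

set_option linter.dupNamespace false

namespace Summit.QuantumAdvantage.QuantumAdvantage.Cruxes.Target.DyadicGapBirthQSignNotInP

open Literature.Computability.Complexity
open Summit.QuantumAdvantage.QuantumAdvantage.Theses.DyadicGap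
open scoped Classical

/-- the piece (local copy; becomes the route decl `Theses.DyadicGap.QSignNotInP` after the split) -/
def QSignNotInP : Prop :=
  ∃ (F : Literature.Computability.Cryptography.QCircuitFamily Literature.Computability.Cryptography.toffoliH) (c : ℕ), F.IsOracleFree ∧ @Literature.Computability.Cryptography.QCircuitFamily.IsUniform Literature.Computability.Cryptography.toffoliH (inferInstanceAs (Encodable Literature.Computability.Cryptography.ToffoliHOp)) F ∧ (∀ x : List Bool, ∃ (q : ℕ) (k : ℤ), 2 ^ q ≤ (x.length + 2) ^ c ∧ ((F.circ x.length).mat (Literature.Computability.Cryptography.padInput x.get (F.ancillas x.length)) (Literature.Computability.Cryptography.padInput x.get (F.ancillas x.length))) = (k : ℂ) / (2 : ℂ) ^ q) ∧ ({x : List Bool | 0 < ((F.circ x.length).mat (Literature.Computability.Cryptography.padInput x.get (F.ancillas x.length)) (Literature.Computability.Cryptography.padInput x.get (F.ancillas x.length))).re} : Language Bool) ∉ Literature.Computability.Complexity.Classes.P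

/-- **stub 1 (PROVABLE; = route support item CoExactIsQuantizedSign, stmt-QuantumAdvantage-1847).** -/
theorem stub_coexact : Summit.QuantumAdvantage.QuantumAdvantage.Theses.DyadicGap.CoExactIsQuantizedSign := by
  sorry

/-- **stub 2 (OPEN).** `EQP_{Toffoli+H} ⊄ P`: some language decided with ZERO error by a poly-time uniform oracle-free Toffoli+H
family is not in `P`. -/
theorem stub_exactToffoliHNotInP : ∃ L ∈ @Literature.Computability.Cryptography.BQPWith Literature.Computability.Cryptography.toffoliH (inferInstanceAs (Encodable Literature.Computability.Cryptography.ToffoliHOp)) 0, L ∉ Literature.Computability.Complexity.Classes.P := by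
  sorry

/-! ## Name-keyed alias of the open stub's statement (the native skeleton audit admits a hypothesis only if its head constant is
a registered obligation — `CoExactIsQuantizedSign` is the route item — or carries a declared stub's name; PlLift pattern). -/

namespace Registered

/-- Alias of stub 2's statement keyed by the registered stub name. -/
abbrev stub_exactToffoliHNotInP : Prop := ∃ L ∈ @Literature.Computability.Cryptography.BQPWith Literature.Computability.Cryptography.toffoliH (inferInstanceAs (Encodable Literature.Computability.Cryptography.ToffoliHOp)) 0, L ∉ Literature.Computability.Complexity.Classes.P

end Registered

/-- **Composition of the birth line** (kernel-checked): piece X₁ (stated verbatim) from the two stubs BY NAME. -/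
theorem QSignNotInP_of
    (hco : Summit.QuantumAdvantage.QuantumAdvantage.Theses.DyadicGap.CoExactIsQuantizedSign)
    (hex : Registered.stub_exactToffoliHNotInP) :
    QSignNotInP := by
  obtain ⟨L, hL0, hLP⟩ := hex
  obtain ⟨F, hof, hu, hamp⟩ := hco L hL0
  refine ⟨F, 0, hof, hu, fun x => ?_, ?_⟩
  · by_cases hx : x ∈ L
    · refine ⟨0, -1, by simp, ?_⟩
      rw [hamp x, if_pos hx]
      simp
    · refine ⟨0, 1, by simp, ?_⟩
      rw [hamp x, if_neg hx]
      simp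
  · have hset : ({x : List Bool | 0 < ((F.circ x.length).mat (Literature.Computability.Cryptography.padInput x.get (F.ancillas x.length)) (Literature.Computability.Cryptography.padInput x.get (F.ancillas x.length))).re} : Language Bool) = Lᶜ := by
      ext x
      change 0 < ((F.circ x.length).mat (Literature.Computability.Cryptography.padInput x.get (F.ancillas x.length)) (Literature.Computability.Cryptography.padInput x.get (F.ancillas x.length))).re ↔ x ∉ L
      rw [hamp x]
      by_cases hx : x ∈ L
      · rw [if_pos hx]; simp [hx]
      · rw [if_neg hx]; simp [hx]
    rw [hset]
    exact fun hc => hLP (compl_mem_P_iff.1 hc)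

/-- Wiring check: the stub theorems feed `QSignNotInP_of` as stated (unnamed, so that `QSignNotInP_of` stays the only declaration
concluding the piece by name; sorries only inside `stub_*`). -/
example : QSignNotInP := QSignNotInP_of stub_coexact stub_exactToffoliHNotInP

end Summit.QuantumAdvantage.QuantumAdvantage.Cruxes.Target.DyadicGapBirthQSignNotInP
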